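import Summits.ResolutionOfSingularities.ResolutionOfSingularities.Theorems.WallCutRun3
import Summits.ResolutionOfSingularities.ResolutionOfSingularities.Theorems.WallCutCritical
import Summits.ResolutionOfSingularities.ResolutionOfSingularities.Theorems.ConeCutWalks
import Summits.ResolutionOfSingularities.ResolutionOfSingularities.Theorems.TightCutCharts
import Summits.ResolutionOfSingularities.ResolutionOfSingularities.Theorems.ExitLawWalks
import Literature.AlgebraicGeometry.Resolution.WeightedBlowupNoIncrease
import HarnessLib

/-!
# WallCutBottom — THE BOTTOM-RUN LAW: a total loss at the bottom of the sub-critical lossy class followed by a full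
straight run is IMPOSSIBLE (kernel, hypothesis-free, port-free; all `p`, `e`, `K`, all shades `s ≥ 3`)

decomp-res-lens-3, gen 26 (entrance-first located cut (a‴-kind) of `WallCut.NoLossyStrictTailsDeep`, critic rows 189/189b/189c).

THE KIND (structural, named by mechanism, all `pᵉ`).  On a shade-`s` plateau a TOTAL LOSS at stage `t` (after the move the
newest wall `E_j`, `j = j_t`, is the only wall) is a BOTTOM loss when the order right after it is the least possible one,
`ordZero F_{t+1} = q + 1` (loss defect `δ = 1`; then `E_j` has mass `m = q + 1 − s`).  A FULL STRAIGHT RUN after it is the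
sequence of `s − 2` UNtranslated moves at the origin of one chart `i ≠ j` on the plateau (the longest run the ledger allows:
along it `r = k·e_i + m·e_j`, `o = q + 1 + k`, and `k = s − 1` would put `(s − 1) + m = q` on two walls, against the pair rule).

THE LAW (`bottom_run_false`).  Such a configuration admits NO further plateau move: the stage `u = t + s − 1` after the run
is a dead end of the forced walk.  Mechanism (the LOSS-ISOLATION lever of NODE-g25 made quantitative by the tree's run calculus
`Theorems.WallCutRun` and closed by the tree's CONE LAW `ConeCut.cone_of_plateau`):
* TOKEN (`token_shape`, `token_mem`): the first-run survival theorem `WallCutRun.exists_token_of_run_after_move`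
with `k = s − 2`
  leaves exactly ONE lattice point in its region: `F_{t+1}` contains `u_i^{2s−2} u_j^{q−1}`; transported along the run
  (`WallCutRun.thin_run`) it is the monomial `d' = u_i^{s} u_j^{q−1}` of `F_u`, of degree `o_u = q + s − 1` (a
tangent-cone monomial).
* CLASSIFICATION (`thin_class_succ`, `cone_class`): by `WallCutRun.source_run` + `exists_token_le_of_thin` every
monomial of `F_u`
  thin for `i` is `u_i^{s+n} u_j^{q−1}`; hence every tangent-cone monomial of `F_u` has `u_i`-degree `≤ s`, with
equality only at `d'`.
* EXITS at the move `u` (chart `c`, point `b`): `c = j`, or `c = l` with `b_j ≠ 0` — the residual form `N_u` (tree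
  `ConeCut.resForm`), homogeneous of degree `s ≥ 3` by the cone law, has the non-zero coefficient `κ·b_y^{…}` at `u_i^2`
  (`coeff_resForm_single_two`): contradiction; `c = l`, `b_j = b_i = 0` — three positive walls against DEAD; `c =
l`, `b_j = 0 ≠ b_i`
  and `c = i`, `b_j = 0` — two walls of total mass `m + (s − 1) = q` against the pair rule; `c = i`, `b_j ≠ 0`
(second total loss
  through the older wall) — RADIAL TEST (`radial_identity`): substituting `u_x ↦ b_x·(X − 1)` in `N_u` gives `N_u(b)·(X − 1)^s`
  by homogeneity and `X^{s−2}·Q(X)` with `Q(0) = κ·b_j^{s−2} ≠ 0`, `deg Q ≤ 2` by the classification; evaluating at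
`X = 0` kills
  `N_u(b)`, whence `Q = 0`: contradiction.
THE CUT (exact, hypothesis-free): `WallCut.NoLossyStrictTailsDeep ↔ NoBottomRunLossTailsDeep ∧ NoLossyOffBottomRunTailsDeep`
(`noLossyStrictTailsDeep_iff`), the decided side `noBottomRunLossTailsDeep_holds` PROVED here, so the located residual is
RE-LOCATED to `NoLossyOffBottomRunTailsDeep` (`noLossyStrictTailsDeep_iff_offBottomRun`): LOSSY strict small-dead
sub-critical tails
in which, from the plateau onset on, NO bottom loss is followed by a full straight run.  Both classes carry the binders of
`WallCut.NoLossyStrictTailsDeep` VERBATIM plus ONE binder.  Entrance certificate, probe and the open side's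
entrance: NODE-g26.md.
(Sources: Hauser2010 §§D,F,G; HauserPerlega2019 §3; Moh1987; CossartPiltant2019 §2.)
-/

open MvPolynomial Finset
open Literature.AlgebraicGeometry.Resolution
open Literature.AlgebraicGeometry.Resolution.Hauser2010
open Literature.AlgebraicGeometry.Resolution.PointBlowup
open Literature.AlgebraicGeometry.Resolution.WeightedBlowup (coeff_translate_monomial)
open Summit.ResolutionOfSingularities.ResolutionOfSingularities.Theorems.TightDefectClasses
open Summit.ResolutionOfSingularities.ResolutionOfSingularities.Theorems.TightDefectStrongWalks
open Summit.ResolutionOfSingularities.ResolutionOfSingularities.Theorems.ItineraryCutClasses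
open Summit.ResolutionOfSingularities.ResolutionOfSingularities.Theorems.BoundaryLedger
open Summit.ResolutionOfSingularities.ResolutionOfSingularities.Theorems.ProximityCut
open Summit.ResolutionOfSingularities.ResolutionOfSingularities.Theorems.WallCutRun
open Summit.ResolutionOfSingularities.ResolutionOfSingularities.Theorems.WallCut
open Summit.ResolutionOfSingularities.ResolutionOfSingularities.Theorems.ConeCut (resForm resLayer cone_of_plateau)

namespace Summit.ResolutionOfSingularities.ResolutionOfSingularities.Theorems.WallCutBottom

/-! ## §0 Three coordinates -/

section Fin3

/-- The third coordinate. [folklore] -/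
theorem exists_third {i j : Fin 3} (hij : i ≠ j) : ∃ l : Fin 3, l ≠ i ∧ l ≠ j := by
  revert i j; decide

/-! Writer g13 (gate dedup, pre-flight of the first proposal): the node's `fin3_eq_or` and `prod_eq_three` restate the LANDED
`ExitLaw.fin3_cases` (`Theorems/ExitLawWalks.lean`) and `TightCut.TightRepeat.prod_three` (`Theorems/TightCutCharts.lean`) with the
same binder shapes; the copies are deleted and every use below and in `WallCutBottom2` cites the landed declarations (imports added;
both modules sit in the same import cone as `WallCutRun3`). No other declaration text changed. -/

/-- `univ = {i, j, l}`. [folklore] -/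
theorem univ_eq_three {i j l : Fin 3} (hij : i ≠ j) (hli : l ≠ i) (hlj : l ≠ j) :
    (Finset.univ : Finset (Fin 3)) = {i, j, l} := by
  ext x
  simp only [Finset.mem_univ, Finset.mem_insert, Finset.mem_singleton, true_iff]
  exact ExitLaw.fin3_cases hij hli hlj x

/-- Degree in three named coordinates. [folklore] -/
theorem degree_eq_three {i j l : Fin 3} (hij : i ≠ j) (hli : l ≠ i) (hlj : l ≠ j) (d : Fin 3 →₀ ℕ) :
    d.degree = d i + d j + d l := by
  rw [Finsupp.degree_eq_sum, univ_eq_three hij hli hlj, Finset.sum_insert, Finset.sum_insert, Finset.sum_singleton,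
    add_assoc]
  · simp [hlj.symm]
  · simp [hij, hli.symm]

/-- Extensionality in three named coordinates. [folklore] -/
theorem ext_three {i j l : Fin 3} (hij : i ≠ j) (hli : l ≠ i) (hlj : l ≠ j) {d e : Fin 3 →₀ ℕ}
    (hi : d i = e i) (hj : d j = e j) (hl : d l = e l) : d = e := by
  ext x
  rcases ExitLaw.fin3_cases hij hli hlj x with h | h | h <;> rw [h] <;> assumption

end Fin3

/-! ## §1 Two univariate identities for the radial test -/

section Radial

variable {K : Type} [Field K]

/-- `aeval (x ↦ b_x·P)` of a monomial: `a·Π b^E · P^{|E|}`. [folklore] -/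
theorem aeval_C_mul_monomial (b : Fin 3 → K) (P : Polynomial K) (E : Fin 3 →₀ ℕ) (a : K) :
    aeval (fun x => Polynomial.C (b x) * P) (monomial E a) = Polynomial.C (a * ∏ x, b x ^ E x) * P ^ E.degree := by
  rw [aeval_monomial, Finsupp.prod_fintype _ _ (fun i => pow_zero _), Polynomial.algebraMap_eq, Finsupp.degree_eq_sum]
  simp only [mul_pow, Finset.prod_mul_distrib, Finset.prod_pow_eq_pow_sum, map_mul, map_prod, map_pow, mul_assoc]

/-- **Radial identity of a form (PROVED).**  For a form `N` of degree `n`, `N(b·P) = N(b)·P^n`. [folklore] -/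
theorem aeval_C_mul_of_isHomogeneous (b : Fin 3 → K) (P : Polynomial K) {N : MvPolynomial (Fin 3) K} {n : ℕ}
    (hN : N.IsHomogeneous n) :
    aeval (fun x => Polynomial.C (b x) * P) N = Polynomial.C (MvPolynomial.eval b N) * P ^ n := by
  classical
  conv_lhs => rw [N.as_sum]
  rw [map_sum]
  have h : ∀ D ∈ N.support, aeval (fun x => Polynomial.C (b x) * P) (monomial D (coeff D N)) =
      Polynomial.C (coeff D N * ∏ x, b x ^ D x) * P ^ n := by
    intro D hD
    rw [aeval_C_mul_monomial]
    have hdeg : D.degree = n := by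
      by_contra h
      exact (mem_support_iff.mp hD) (hN.coeff_eq_zero h)
    rw [hdeg]
  rw [Finset.sum_congr rfl h, ← Finset.sum_mul, ← map_sum, MvPolynomial.eval_eq']

/-- `aeval` after a translation. [folklore] -/
theorem aeval_translate (g : Fin 3 → Polynomial K) (b : Fin 3 → K) (M : MvPolynomial (Fin 3) K) :
    aeval g (translate b M) = aeval (fun x => g x + Polynomial.C (b x)) M := by
  unfold PointBlowup.translate
  rw [← AlgHom.comp_apply, MvPolynomial.comp_aeval]
  have h : (fun x => aeval g (X x + C (b x))) = fun x => g x + Polynomial.C (b x) := by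
    funext x
    rw [map_add, aeval_X, algHom_C, Polynomial.algebraMap_eq]
  rw [h]

end Radial

/-! ## §2 The bottom-run configuration: ledger, token, classification -/

section Run

variable {K : Type} [Field K] [DecidableEq K] {q : ℕ} {s₀ : State (Fin 3) K}

/-- **LEMMA A — data of a BOTTOM loss (PROVED).**  On a plateau of shade `s`, a total loss at `t` with `ordZero F_{t+1} = q + 1`
and `ordZero F_t ≠ q` has `ordZero F_t = q + m`, `s + m = q + 1`, `m ≥ 1`, `kept_t = 0`, `r_{t+1} = m·e_j`. [new] [folklore] -/
theorem bottom_loss_data (hroot : IsRoot q s₀) (W : ForcedWalk q s₀) (t : ℕ) {s : ℕ}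
    (hsh0 : (W.st t).shade = (s : ℕ∞)) (hsh1 : (W.st (t + 1)).shade = (s : ℕ∞))
    (hloss : ∀ y, y ≠ W.j t → (W.st (t + 1)).r y = 0)
    (ho1 : ordZero (W.st (t + 1)).F = ((q + 1 : ℕ) : ℕ∞)) (hne : ordZero (W.st t).F ≠ ((q : ℕ) : ℕ∞)) :
    ∃ m : ℕ, ordZero (W.st t).F = ((q + m : ℕ) : ℕ∞) ∧ s + m = q + 1 ∧ 1 ≤ m ∧ q + m = s + (W.st t).r.degree ∧
      kept W t = 0 ∧ (W.st (t + 1)).r = Finsupp.single (W.j t) m := by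
  classical
  obtain ⟨o, ho, hqo⟩ := walk_nat hroot W t
  obtain ⟨s', hs', hos'⟩ := order_eq_shade_add_degree hroot W t ho
  have hss' : s' = s := by have h := hs'.symm.trans hsh0; exact_mod_cast h
  have hkept : kept W t = 0 := by
    ext y
    by_cases hy : y = W.j t
    · rw [kept_apply, if_neg (fun h => h.1 hy)]; rfl
    · have h1 := hloss y hy
      rw [r_succ_eq W t ho, Finsupp.add_apply, Finsupp.single_apply, if_neg (fun h => hy h.symm), add_zero] at h1
      rw [h1]; rfl
  have hdeg := degree_r_succ W t ho
  rw [hkept, map_zero, zero_add] at hdeg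
  obtain ⟨s'', hs'', hos''⟩ := order_eq_shade_add_degree hroot W (t + 1) ho1
  have hss'' : s'' = s := by have h := hs''.symm.trans hsh1; exact_mod_cast h
  have hoq : o ≠ q := by
    intro h; rw [h] at ho; exact hne ho
  refine ⟨o - q, ?_, by omega, by omega, by omega, hkept, ?_⟩
  · rw [ho]; congr 1; omega
  · rw [r_succ_eq W t ho, hkept, zero_add]

/-- **LEMMA B — the run ledger (PROVED).**  After the bottom loss, `k` untranslated moves in chart `i ≠ j` on the plateau give
`ordZero F_{t+1+k} = q + k + 1`, `r_{t+1+k} off i = m·e_j`, `r_{t+1+k}(i) = k`. [new] [folklore] -/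
theorem bottom_run_data (hroot : IsRoot q s₀) (W : ForcedWalk q s₀) (t k : ℕ) {s m : ℕ} {i : Fin 3} (hij : i ≠ W.j t)
    (hsm : s + m = q + 1) (hr1 : (W.st (t + 1)).r = Finsupp.single (W.j t) m)
    (ho1 : ordZero (W.st (t + 1)).F = ((q + 1 : ℕ) : ℕ∞))
    (hrun : ∀ l, l < k → W.j (t + 1 + l) = i ∧ W.b (t + 1 + l) = 0)
    (hsh : ∀ l, l ≤ k → (W.st (t + 1 + l)).shade = (s : ℕ∞)) :
    ordZero (W.st (t + 1 + k)).F = ((q + k + 1 : ℕ) : ℕ∞) ∧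
      Finsupp.erase i (W.st (t + 1 + k)).r = Finsupp.single (W.j t) m ∧ (W.st (t + 1 + k)).r i = k := by
  classical
  obtain ⟨ou, hou, -⟩ := walk_nat hroot W (t + 1 + k)
  obtain ⟨her, hled⟩ := run_order hroot W hrun hsh ho1 hou
  have he1 : Finsupp.erase i (W.st (t + 1)).r = Finsupp.single (W.j t) m := by
    rw [hr1, Finsupp.erase_single_ne hij]
  rw [he1, Finsupp.degree_single, hsm] at hled
  rw [he1] at her
  have hmul : k * (q + 1) = k * q + k := by ring
  have hou' : ou = q + k + 1 := by omega
  obtain ⟨s', hs', hos'⟩ := order_eq_shade_add_degree hroot W (t + 1 + k) hou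
  have hss' : s' = s := by have h := hs'.symm.trans (hsh k le_rfl); exact_mod_cast h
  have hdeg := degree_erase_add (W.st (t + 1 + k)).r i
  rw [her, Finsupp.degree_single] at hdeg
  refine ⟨by rw [hou, hou'], her, by omega⟩

/-- **Token arithmetic (PROVED).**  The region R(s, 0, 0, q + m, k, q) of `exists_token_of_run_after_move` for a bottom loss
(`s + m = q + 1`) and a FULL run (`k = s − 2`) is the single point `(2s − 2, q − 1, 0)`. [new] [folklore] -/
theorem token_shape {k m s o κ κ' : ℕ} {i j l : Fin 3} (hij : i ≠ j) (hli : l ≠ i) (hlj : l ≠ j)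
    (hs : s = k + 2) (hsm : s + m = q + 1) (ho : o = q + m) (hκ : κ = 0) (hκ' : κ' = 0) {d : Fin 3 →₀ ℕ}
    (h1 : o ≤ d j + q) (h2 : (Finsupp.erase i d).degree < q)
    (h3 : (Finsupp.erase j d).degree + o ≤ κ + s + d j + q)
    (h4 : (s + κ + o) + k * (s + κ' + o) ≤ d.degree + k * (Finsupp.erase i d).degree + (k + 1) * q) :
    d i = 2 * k + 2 ∧ d j = q - 1 ∧ d l = 0 := by
  have hdeg3 := degree_eq_three hij hli hlj d
  have hei := degree_erase_add d i
  have hej := degree_erase_add d j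
  have hei3 := degree_eq_three hij hli hlj (Finsupp.erase i d)
  rw [Finsupp.erase_same, Finsupp.erase_ne hij.symm, Finsupp.erase_ne hli] at hei3
  have hej3 := degree_eq_three hij hli hlj (Finsupp.erase j d)
  rw [Finsupp.erase_same, Finsupp.erase_ne hij, Finsupp.erase_ne hlj] at hej3
  subst hκ hκ' ho hs
  set E := (Finsupp.erase i d).degree with hE
  have e1 : k + 2 + 0 + (q + m) = 2 * q + 1 := by omega
  rw [e1] at h4
  have e2 : k * (2 * q + 1) = 2 * (k * q) + k := by ring
  have e3 : (k + 1) * q = k * q + q := by ring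
  rw [e2, e3] at h4
  have h5 : k * E + k ≤ k * q := by
    have := Nat.mul_le_mul_left k (Nat.succ_le_of_lt h2)
    rwa [Nat.mul_succ] at this
  omega

variable (W : ForcedWalk q s₀) in
/-- The token / tangent-cone monomial `a·e_i + (q − 1)·e_j`. DEFINITION (support). -/
noncomputable def tok (i : Fin 3) (t a : ℕ) : Fin 3 →₀ ℕ :=
  Finsupp.single i a + Finsupp.single (W.j t) (q - 1)

/-- `tok_apply_i`: Auxiliary step of this node's calculus, VERBATIM from the lens file (see the module docstring);
the statement is its type. [folklore] -/
theorem tok_apply_i (W : ForcedWalk q s₀) {t : ℕ} {i : Fin 3} (hij : i ≠ W.j t) (a : ℕ) : tok W i t a i = a := by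
  unfold tok; rw [Finsupp.add_apply, Finsupp.single_eq_same, Finsupp.single_apply, if_neg hij.symm, add_zero]

/-- `tok_apply_j`: Auxiliary step of this node's calculus, VERBATIM from the lens file (see the module docstring);
the statement is its type. [folklore] -/
theorem tok_apply_j (W : ForcedWalk q s₀) {t : ℕ} {i : Fin 3} (hij : i ≠ W.j t) (a : ℕ) : tok W i t a (W.j t) = q - 1 := by
  unfold tok; rw [Finsupp.add_apply, Finsupp.single_eq_same, Finsupp.single_apply, if_neg hij, zero_add]

/-- `tok_apply_l`: Auxiliary step of this node's calculus, VERBATIM from the lens file (see the module docstring);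
the statement is its type. [folklore] -/
theorem tok_apply_l (W : ForcedWalk q s₀) {t : ℕ} {i l : Fin 3} (hli : l ≠ i) (hlj : l ≠ W.j t) (a : ℕ) : tok W i t a l = 0 := by
  unfold tok
  rw [Finsupp.add_apply, Finsupp.single_apply, if_neg hli.symm, Finsupp.single_apply, if_neg hlj.symm, add_zero]

/-- The hypotheses of the bottom-run configuration, bundled. DEFINITION (support). -/
structure BottomRun (hroot : IsRoot q s₀) (W : ForcedWalk q s₀) (t k s m : ℕ) (i l : Fin 3) : Prop where
  hij : i ≠ W.j t
  hli : l ≠ i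
  hlj : l ≠ W.j t
  hs : s = k + 2
  hsm : s + m = q + 1
  hm : 1 ≤ m
  ho : ordZero (W.st t).F = ((q + m : ℕ) : ℕ∞)
  hos : q + m = s + (W.st t).r.degree
  hkept : kept W t = 0
  hr1 : (W.st (t + 1)).r = Finsupp.single (W.j t) m
  ho1 : ordZero (W.st (t + 1)).F = ((q + 1 : ℕ) : ℕ∞)
  hrun : ∀ l', l' < k → W.j (t + 1 + l') = i ∧ W.b (t + 1 + l') = 0
  hsh : ∀ l', l' ≤ k → (W.st (t + 1 + l')).shade = (s : ℕ∞)

variable {hroot : IsRoot q s₀} {W : ForcedWalk q s₀} {t k s m : ℕ} {i l : Fin 3}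

/-- **TOKEN (PROVED).**  `u_i^{2s−2} u_j^{q−1} ∈ supp F_{t+1}`. [new] [folklore] -/
theorem token_mem (B : BottomRun hroot W t k s m i l) : tok W i t (2 * k + 2) ∈ (W.st (t + 1)).F.support := by
  classical
  obtain ⟨d, hd, h1, h2, h3, h4⟩ := exists_token_of_run_after_move hroot W t k B.ho B.hos (by have := B.hm; omega) B.hij B.hrun B.hsh
  obtain ⟨hi, hj, hl⟩ := token_shape (κ := (kept W t).degree) (κ' := (Finsupp.erase i (kept W t)).degree) B.hij B.hli B.hlj B.hs
    B.hsm rfl (by rw [B.hkept, map_zero]) (by rw [B.hkept, Finsupp.erase_zero, map_zero]) h1 h2 h3 h4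
  have : d = tok W i t (2 * k + 2) :=
    ext_three B.hij B.hli B.hlj (by rw [hi, tok_apply_i W B.hij]) (by rw [hj, tok_apply_j W B.hij])
      (by rw [hl, tok_apply_l W B.hli B.hlj])
  rw [← this]; exact hd

/-- **CLASSIFICATION AT `t + 1` (PROVED).**  Every monomial of `F_{t+1}` thin for `i` has `j`-exponent `q − 1` and
`l`-exponent `0`. [new] [folklore] -/
theorem thin_class_succ (B : BottomRun hroot W t k s m i l) {e : Fin 3 →₀ ℕ} (he : e ∈ (W.st (t + 1)).F.support)
    (hthin : (Finsupp.erase i e).degree < q) : e (W.j t) = q - 1 ∧ e l = 0 := by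
  classical
  obtain ⟨d, hde, hd, h1, h2, h3, h4⟩ := exists_token_le_of_thin hroot W t k B.ho B.hos (by have := B.hm; omega) B.hij B.hrun
    B.hsh he hthin
  obtain ⟨hi, hj, hl⟩ := token_shape (κ := (kept W t).degree) (κ' := (Finsupp.erase i (kept W t)).degree) B.hij B.hli B.hlj B.hs
    B.hsm rfl (by rw [B.hkept, map_zero]) (by rw [B.hkept, Finsupp.erase_zero, map_zero]) h1 h2 h3 h4
  have hje : d (W.j t) ≤ e (W.j t) := hde (W.j t)
  have hthin3 := degree_eq_three B.hij B.hli B.hlj (Finsupp.erase i e)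
  rw [Finsupp.erase_same, Finsupp.erase_ne B.hij.symm, Finsupp.erase_ne B.hli] at hthin3
  have hm := B.hm; have hsm := B.hsm
  omega

/-- **CLASSIFICATION AT THE END OF THE RUN (PROVED).**  The same holds for `F_{t+1+k}` (pull-back along the run).
[new] [folklore] -/
theorem thin_class_run (B : BottomRun hroot W t k s m i l) {e : Fin 3 →₀ ℕ} (he : e ∈ (W.st (t + 1 + k)).F.support)
    (hthin : (Finsupp.erase i e).degree < q) : e (W.j t) = q - 1 ∧ e l = 0 := by
  classical
  obtain ⟨e₀, he₀, her, -⟩ := source_run hroot W B.hrun he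
  have hthin₀ : (Finsupp.erase i e₀).degree < q := by rw [her]; exact hthin
  obtain ⟨hj, hl⟩ := thin_class_succ B he₀ hthin₀
  have h1 := congrArg (fun f => f (W.j t)) her
  have h2 := congrArg (fun f => f l) her
  simp only [Finsupp.erase_ne B.hij.symm, Finsupp.erase_ne B.hli] at h1 h2
  exact ⟨by rw [← h1, hj], by rw [← h2, hl]⟩

/-- **TANGENT-CONE CLASSIFICATION (PROVED).**  A monomial of `F_{t+1+k}` of degree `q + k + 1` has `i`-exponent `≤ s
= k + 2`, with
equality only for `d' = u_i^{s} u_j^{q−1}`. [new] [folklore] -/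
theorem cone_class (B : BottomRun hroot W t k s m i l) {d : Fin 3 →₀ ℕ} (hd : d ∈ (W.st (t + 1 + k)).F.support)
    (hdeg : d.degree = q + k + 1) : d i ≤ k + 2 ∧ (d i = k + 2 → d = tok W i t (k + 2)) := by
  classical
  have hd3 := degree_eq_three B.hij B.hli B.hlj d
  have he3 := degree_eq_three B.hij B.hli B.hlj (Finsupp.erase i d)
  rw [Finsupp.erase_same, Finsupp.erase_ne B.hij.symm, Finsupp.erase_ne B.hli] at he3
  by_cases hbig : k + 2 ≤ d i
  · have hthin : (Finsupp.erase i d).degree < q := by have := B.hm; have := B.hsm; omega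
    obtain ⟨hj, hl⟩ := thin_class_run B hd hthin
    have hm := B.hm; have hsm := B.hsm
    have hi : d i = k + 2 := by omega
    refine ⟨hi.le, fun _ => ext_three B.hij B.hli B.hlj ?_ ?_ ?_⟩
    · rw [hi, tok_apply_i W B.hij]
    · rw [hj, tok_apply_j W B.hij]
    · rw [hl, tok_apply_l W B.hli B.hlj]
  · exact ⟨by omega, fun h => by omega⟩

/-- **THE TANGENT-CONE MONOMIAL (PROVED).**  `d' = u_i^{s} u_j^{q−1} ∈ supp F_{t+1+k}`, of degree `q + k + 1`. [new]
[folklore] -/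
theorem tok_mem_run (B : BottomRun hroot W t k s m i l) :
    tok W i t (k + 2) ∈ (W.st (t + 1 + k)).F.support ∧ (tok W i t (k + 2)).degree = q + k + 1 := by
  classical
  have hmem := token_mem B
  have ht3 := degree_eq_three B.hij B.hli B.hlj (Finsupp.erase i (tok W i t (2 * k + 2)))
  rw [Finsupp.erase_same, Finsupp.erase_ne B.hij.symm, Finsupp.erase_ne B.hli, tok_apply_j W B.hij,
    tok_apply_l W B.hli B.hlj] at ht3
  have hT3 := degree_eq_three B.hij B.hli B.hlj (tok W i t (2 * k + 2))
  rw [tok_apply_i W B.hij, tok_apply_j W B.hij, tok_apply_l W B.hli B.hlj] at hT3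
  have hm := B.hm; have hsm := B.hsm; have hs := B.hs
  have hthin : (Finsupp.erase i (tok W i t (2 * k + 2))).degree < q := by omega
  obtain ⟨e, he, her, hdeg⟩ := thin_run hroot W B.hrun hmem hthin
  rw [ht3] at hdeg
  have hq1 : q - (0 + (q - 1) + 0) = 1 := by omega
  rw [hq1, Nat.mul_one] at hdeg
  obtain ⟨hj, hl⟩ := thin_class_run B he (by rw [her]; exact hthin)
  have he3 := degree_eq_three B.hij B.hli B.hlj e
  have hdeg' : (tok W i t (k + 2)).degree = q + k + 1 := by
    rw [degree_eq_three B.hij B.hli B.hlj, tok_apply_i W B.hij, tok_apply_j W B.hij, tok_apply_l W B.hli B.hlj]; omega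
  have : e = tok W i t (k + 2) := ext_three B.hij B.hli B.hlj (by rw [tok_apply_i W B.hij]; omega)
    (by rw [hj, tok_apply_j W B.hij]) (by rw [hl, tok_apply_l W B.hli B.hlj])
  exact ⟨this ▸ he, hdeg'⟩

end Run

end Summit.ResolutionOfSingularities.ResolutionOfSingularities.Theorems.WallCutBottom
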